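import Summits.PneNP.PneNP.Theorems.SzkEntropyPeaThreeNotInPLatticeDefs
import HarnessLib

/-!
# Route SzkEntropy, crux `PeaThreeNotInP` (stmt-PneNP-10776), line `SketchIdeator3`, socket client
# `lattice-cube-smoothing`: stub `stub_bpSemantics` (W1) — the kernels of the two samplers

The program lists `progsP`, `progsQ` of the lattice client (definitions file
`SzkEntropyPeaThreeNotInPLatticeDefs`) sample, on the input bits `u = (b, z, e)`, the string of the
`W` low bits of the translated coordinates `affineVal (csP i) u` (`i < n`), resp. of
`affineVal (csQ i) u` followed by the bit `b`: program `r = i W + j` is the carry automaton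
`affineBitRaw (cs i) j`, which computes bit `j` of `affineVal (cs i) u` (`stub_affineBitRaw_fn`).
Since `affineVal cs u = Σ_k cs_k [u_k] + Σ_{cs_k < 0} |cs_k|` (a constant translate of the signed
form) and binary expansion is injective below `2^W`, two inputs give the same output string iff
they give the same signed forms, i.e. the same `(yP u i)_{i<n}`, resp. the same
`((yQ u i)_{i<n}, b)` — the kernel description `stub_bpSemantics` feeding `stub_reindex`.

References: Z. Dvir, D. Gutfreund, G. N. Rothblum, S. Vadhan, ECCC TR10-160 (2010) §4.2
(branching-program samplers); I. Wegener, *Branching programs and binary decision diagrams*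
(2000) §1.1 (programs for addition).
-/

namespace Summit.PneNP.PneNP.Cruxes.PeaThreeNotInP.LatticeLine

set_option linter.dupNamespace false -- `Summit.PneNP.PneNP.…`: summit = sub-problem name (D-0017)

open Finset
open Literature.Computability.Complexity
open Literature.Computability.Cryptography (toInput fnList)
open Summit.PneNP.PneNP.Cruxes.PeaThreeNotInP.SocketBP (affineBitRaw affineVal stub_affineBitRaw_fn)

/-! ### The programs compute the bits of the affine values -/

/-- The compiled carry automaton over `N = |cs|` variables computes bit `j` of the affine value
(`stub_affineBitRaw_fn` transported along `|cs| = N`). [cite: Wegener2000, §1.1] -/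
theorem sem_compile_fn (cs : List ℤ) (j N : ℕ) (h : cs.length = N) (u : Fin N → Bool) :
    (RawBP.compile N (affineBitRaw cs j)).2.fn u =
      (affineVal cs fun k => u (Fin.cast h k)).testBit j := by
  subst h
  exact (stub_affineBitRaw_fn cs j u).2

/-- The same for a family of coefficient lists of common length `N`. [cite: Wegener2000, §1.1] -/
theorem sem_compile_fn' {N : ℕ} (cs : ℕ → List ℤ) (hlen : ∀ i, (cs i).length = N) (i j : ℕ)
    (u : Fin N → Bool) :
    (RawBP.compile N (affineBitRaw (cs i) j)).2.fn u =
      (affineVal (cs i) fun k => u (Fin.cast (hlen i) k)).testBit j :=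
  sem_compile_fn (cs i) j N (hlen i) u

/-- The sampled string is the list of the bits computed by the compiled programs.
[cite: DvirGutfreundRothblumVadhan2010, §4.2] -/
theorem sem_bpMap_eq (N : ℕ) (Bs : List RawBP) (x : Fin N → ZMod 2) :
    bpMap N Bs x = Bs.map fun B => (RawBP.compile N B).2.fn (toInput x) := by
  simp [bpMap, fnList, compileAll, List.map_map, Function.comp_def]

/-- The Boolean input of `x` is its bit sequence `ext x` below `N`. [folklore] -/
theorem sem_toInput_eq {N : ℕ} (x : Fin N → ZMod 2) (k : Fin N) : toInput x k = ext x k.val := by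
  simp [toInput, ext, k.isLt]

/-! ### The affine value is a translate of the signed form -/

/-- `affineVal cs u = Σ_k cs_k [u_k] + Σ_{cs_k < 0} |cs_k|`. [folklore] -/
theorem sem_affineVal_cast (cs : List ℤ) (v : Fin cs.length → Bool) :
    (affineVal cs v : ℤ) = (∑ k : Fin cs.length, cs[k] * (if v k then 1 else 0)) +
      ∑ k : Fin cs.length, (if cs[k] < 0 then -cs[k] else 0) := by
  unfold affineVal
  rw [Nat.cast_sum, ← Finset.sum_add_distrib]
  refine Finset.sum_congr rfl fun k _ => ?_
  simp only [Fin.getElem_fin]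
  by_cases h : 0 ≤ cs[(k : ℕ)]
  · have h' : ¬ cs[(k : ℕ)] < 0 := not_lt.2 h
    cases v k <;> simp [h, h', abs_of_nonneg h]
  · have h' : cs[(k : ℕ)] < 0 := not_le.1 h
    cases v k <;> simp [h, h', abs_of_neg h']

/-- Two inputs have the same affine value iff they have the same signed form. [folklore] -/
theorem sem_affineVal_eq_iff (cs : List ℤ) (v v' : Fin cs.length → Bool) :
    affineVal cs v = affineVal cs v' ↔
      ∑ k : Fin cs.length, cs[k] * (if v k then (1 : ℤ) else 0) =
        ∑ k : Fin cs.length, cs[k] * (if v' k then (1 : ℤ) else 0) := by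
  rw [← Nat.cast_inj (R := ℤ), sem_affineVal_cast, sem_affineVal_cast, add_left_inj]

-- adapted from Literature/Barriers/PneNP/FeasibleInterpolationTransfer.lean (`eq_of_testBit_eq_below`)
/-- Two numbers `< 2^W` with the same `W` low bits are equal. [folklore] -/
theorem sem_eq_of_testBit_eq {W a b : ℕ} (ha : a < 2 ^ W) (hb : b < 2 ^ W)
    (h : ∀ j < W, a.testBit j = b.testBit j) : a = b := by
  refine Nat.eq_of_testBit_eq fun j => ?_
  by_cases hj : j < W
  · exact h j hj
  · have hm : 2 ^ W ≤ 2 ^ j := Nat.pow_le_pow_right (by norm_num) (by omega)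
    rw [Nat.testBit_eq_false_of_lt (lt_of_lt_of_le ha hm),
      Nat.testBit_eq_false_of_lt (lt_of_lt_of_le hb hm)]

/-! ### The signed forms of `csP i`, `csQ i` are `yP · i`, `yQ · i` -/

/-- The signed form of a coefficient list `a :: [f 0, …, f (L-1)]`. [folklore] -/
theorem sem_sum_cons_map (a : ℤ) (L : ℕ) (f g : ℕ → ℤ) (l : List ℤ)
    (hl : l = a :: (List.range L).map f) :
    ∑ k : Fin l.length, l[k] * g k = a * g 0 + ∑ k ∈ range L, f k * g (k + 1) := by
  have hget : ∀ k : Fin l.length, l[k] * g k = l.getD k 0 * g k := fun k => by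
    rw [List.getD_eq_getElem l 0 k.isLt]; rfl
  have hlen : l.length = L + 1 := by simp [hl]
  rw [Finset.sum_congr rfl fun k _ => hget k, Fin.sum_univ_eq_sum_range (fun k => l.getD k 0 * g k),
    hlen, Finset.sum_range_succ', add_comm]
  congr 1
  · rw [hl, List.getD_cons_zero]
  · refine Finset.sum_congr rfl fun k hk => ?_
    rw [hl, List.getD_cons_succ, List.getD_eq_getElem _ 0 (by simpa using hk)]
    simp

/-- Summing over `range (n ℓ)` block by block. [folklore] -/
theorem sem_sum_range_mul (n ℓ : ℕ) (G : ℕ → ℤ) :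
    ∑ k ∈ range (n * ℓ), G k = ∑ i' ∈ range n, ∑ s ∈ range ℓ, G (i' * ℓ + s) := by
  induction n with
  | zero => simp
  | succ n ih => rw [Nat.succ_mul, Finset.sum_range_add, ih, Finset.sum_range_succ]

/-- Quotient and remainder of `i' ℓ + s` by `ℓ` (`s < ℓ`). [folklore] -/
theorem sem_divmod (i' ℓ s : ℕ) (hs : s < ℓ) : (i' * ℓ + s) / ℓ = i' ∧ (i' * ℓ + s) % ℓ = s := by
  have hℓ : 0 < ℓ := by omega
  refine ⟨?_, ?_⟩
  · rw [Nat.mul_comm, Nat.mul_add_div hℓ, Nat.div_eq_of_lt hs, Nat.add_zero]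
  · rw [Nat.mul_comm, Nat.mul_add_mod, Nat.mod_eq_of_lt hs]

/-- The signed form of the `z` / `e` coefficients `coefZE i` at the input bits `1 + k` is the
lattice part `yQ · i`. [folklore] -/
theorem sem_sum_coefZE (c : CVPTup) {i : ℕ} (hi : i < c.n) (u : ℕ → Bool) :
    ∑ k ∈ range c.nzE, c.coefZE i k * (if u (k + 1) then 1 else 0) = c.yQ u i := by
  have hz : ∀ k ∈ range (c.n * c.ℓ), c.coefZE i k * (if u (k + 1) then (1 : ℤ) else 0) =
      (c.K : ℤ) * c.entry (k / c.ℓ) i * 2 ^ (k % c.ℓ) * (if u (k + 1) then 1 else 0) := by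
    intro k hk
    rw [CVPTup.coefZE, if_pos (Finset.mem_range.1 hk)]
  have he : ∀ k ∈ range (c.n * c.m),
      c.coefZE i (c.n * c.ℓ + k) * (if u (c.n * c.ℓ + k + 1) then (1 : ℤ) else 0) =
      (if k / c.m = i then 2 ^ (k % c.m) else 0) * (if u (c.n * c.ℓ + k + 1) then 1 else 0) := by
    intro k _
    rw [CVPTup.coefZE, if_neg (by omega), Nat.add_sub_cancel_left]
  rw [CVPTup.nzE, Finset.sum_range_add, Finset.sum_congr rfl hz, Finset.sum_congr rfl he,
    sem_sum_range_mul, sem_sum_range_mul, CVPTup.yQ]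
  congr 1
  · refine Finset.sum_congr rfl fun i' _ => ?_
    rw [bitsVal, Nat.cast_sum, Finset.mul_sum]
    refine Finset.sum_congr rfl fun s hs => ?_
    have hs' := Finset.mem_range.1 hs
    rw [(sem_divmod i' c.ℓ s hs').1, (sem_divmod i' c.ℓ s hs').2,
      show 1 + i' * c.ℓ + s = i' * c.ℓ + s + 1 by ring]
    split_ifs <;> simp
  · rw [bitsVal, Nat.cast_sum, Finset.sum_eq_single_of_mem i (Finset.mem_range.2 hi)]
    · refine Finset.sum_congr rfl fun s hs => ?_
      have hs' := Finset.mem_range.1 hs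
      rw [(sem_divmod i c.m s hs').1, (sem_divmod i c.m s hs').2, if_pos rfl,
        show c.n * c.ℓ + (i * c.m + s) + 1 = 1 + c.n * c.ℓ + i * c.m + s by ring]
      split_ifs <;> simp
    · intro i'' _ hne
      refine Finset.sum_eq_zero fun s hs => ?_
      rw [(sem_divmod i'' c.m s (Finset.mem_range.1 hs)).1, if_neg hne, zero_mul]

/-- The signed form of `csP i` at the bits of `u` is `yP u i`. [folklore] -/
theorem sem_signed_csP (c : CVPTup) {i : ℕ} (hi : i < c.n) (u : ℕ → Bool) :
    ∑ k : Fin (c.csP i).length, (c.csP i)[k] * (if u k then 1 else 0) = c.yP u i := by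
  rw [sem_sum_cons_map ((c.K : ℤ) * c.tgt i) c.nzE (c.coefZE i) (fun k => if u k then 1 else 0)
    (c.csP i) rfl, sem_sum_coefZE c hi u, CVPTup.yP, add_comm]
  split_ifs <;> simp

/-- The signed form of `csQ i` at the bits of `u` is `yQ u i`. [folklore] -/
theorem sem_signed_csQ (c : CVPTup) {i : ℕ} (hi : i < c.n) (u : ℕ → Bool) :
    ∑ k : Fin (c.csQ i).length, (c.csQ i)[k] * (if u k then 1 else 0) = c.yQ u i := by
  rw [sem_sum_cons_map 0 c.nzE (c.coefZE i) (fun k => if u k then 1 else 0) (c.csQ i) rfl,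
    sem_sum_coefZE c hi u, zero_mul, zero_add]

/-- The last program of `q` reads the bit `b`: `affineVal csB v = [v 0]`. [folklore] -/
theorem sem_affineVal_csB (c : CVPTup) (v : Fin c.csB.length → Bool) :
    affineVal c.csB v = if v ⟨0, by simp [CVPTup.csB]⟩ then 1 else 0 := by
  unfold affineVal
  rw [Finset.sum_eq_single_of_mem (⟨0, by simp [CVPTup.csB]⟩ : Fin c.csB.length)
    (Finset.mem_univ _)]
  · have h0 : c.csB[(⟨0, by simp [CVPTup.csB]⟩ : Fin c.csB.length)] = 1 := by
      simp [Fin.getElem_fin, CVPTup.csB]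
    simp [h0]
  · rintro ⟨k, hk⟩ _ hne
    cases k with
    | zero => exact absurd rfl hne
    | succ j =>
      have h0 : c.csB[(⟨j + 1, hk⟩ : Fin c.csB.length)] = 0 := by
        simp [Fin.getElem_fin, CVPTup.csB]
      simp [h0]

/-! ### Kernels -/

/-- Quantifying over `r < n W` is quantifying over `(r / W, r % W) ∈ [0, n) × [0, W)`. [folklore] -/
theorem sem_forall_range_mul {n W : ℕ} (hW : 0 < W) (P : ℕ → ℕ → Prop) :
    (∀ r < n * W, P (r / W) (r % W)) ↔ ∀ i < n, ∀ j < W, P i j := by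
  constructor
  · intro h i hi j hj
    have h1 := sem_divmod i W j hj
    have h2 : i * W + j < n * W := by
      have := Nat.mul_le_mul_right W (Nat.succ_le_of_lt hi)
      rw [Nat.succ_mul] at this
      omega
    have h3 := h (i * W + j) h2
    rwa [h1.1, h1.2] at h3
  · intro h r hr
    exact h (r / W) ((Nat.div_lt_iff_lt_mul hW).2 hr) (r % W) (Nat.mod_lt r hW)

/-- **Kernel of a block sampler.**  If program `r = i W + j` is the carry automaton of bit `j` of
`affineVal (cs i)`, all values fit in `W` bits and the signed form of `cs i` is `Y · i`, then two
inputs give the same output string iff they give the same `(Y i)_{i<n}`.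
[cite: DvirGutfreundRothblumVadhan2010, §4.2] -/
theorem sem_ker_blocks (c : CVPTup) (cs : ℕ → List ℤ) (hlen : ∀ i, (cs i).length = c.N)
    (Y : (ℕ → Bool) → ℕ → ℤ)
    (hY : ∀ i < c.n, ∀ u : ℕ → Bool,
      ∑ k : Fin (cs i).length, (cs i)[k] * (if u k then 1 else 0) = Y u i)
    (hW : ∀ (i : ℕ) (u : Fin (cs i).length → Bool), i < c.n → affineVal (cs i) u < 2 ^ c.W)
    (x x' : Fin c.N → ZMod 2) :
    ((List.range (c.n * c.W)).map fun r =>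
        (RawBP.compile c.N (affineBitRaw (cs (r / c.W)) (r % c.W))).2.fn (toInput x)) =
      ((List.range (c.n * c.W)).map fun r =>
        (RawBP.compile c.N (affineBitRaw (cs (r / c.W)) (r % c.W))).2.fn (toInput x')) ↔
    (fun i : Fin c.n => Y (ext x) i) = fun i : Fin c.n => Y (ext x') i := by
  have hWpos : 0 < c.W := Nat.succ_pos _
  have hval : ∀ (y : Fin c.N → ZMod 2) (i : ℕ), i < c.n →
      (∑ k : Fin (cs i).length,
        (cs i)[k] * (if toInput y (Fin.cast (hlen i) k) then (1 : ℤ) else 0)) = Y (ext y) i := by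
    intro y i hi
    rw [← hY i hi (ext y)]
    refine Finset.sum_congr rfl fun k _ => ?_
    rw [sem_toInput_eq]
    rfl
  rw [List.map_inj_left]
  simp only [List.mem_range, sem_compile_fn' cs hlen]
  refine (sem_forall_range_mul hWpos fun i j =>
    (affineVal (cs i) fun k => toInput x (Fin.cast (hlen i) k)).testBit j =
      (affineVal (cs i) fun k => toInput x' (Fin.cast (hlen i) k)).testBit j).trans ?_
  simp only [funext_iff, Fin.forall_iff]
  refine forall₂_congr fun i hi => ?_
  rw [← hval x i hi, ← hval x' i hi]
  refine Iff.trans ?_ (sem_affineVal_eq_iff _ _ _)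
  exact ⟨sem_eq_of_testBit_eq (hW i _ hi) (hW i _ hi), fun h j _ => by rw [h]⟩

/-- **(W1) Branching-program semantics.**  Given that every translated output coordinate fits in
`W` bits, two inputs give the same output string of `progsP` iff they give the same vector
`(yP i)_{i<n}`, and the same output string of `progsQ` iff they give the same `((yQ i)_{i<n}, b)`
(each program `(i, j)` computes bit `j` of `affineVal (csP i) = yP i + C_i` by `stub_affineBitRaw_fn`,
the last program of `q` the bit `b`; binary expansion below `2^W` is injective).
[cite: DvirGutfreundRothblumVadhan2010, §4.2] -/
theorem stub_bpSemantics (c : CVPTup) (hWP : ∀ (i : ℕ) (u : Fin (c.csP i).length → Bool), i < c.n → affineVal (c.csP i) u < 2 ^ c.W) (hWQ : ∀ (i : ℕ) (u : Fin (c.csQ i).length → Bool), i < c.n → affineVal (c.csQ i) u < 2 ^ c.W) : (∀ x x' : Fin c.N → ZMod 2, bpMap c.N c.progsP x = bpMap c.N c.progsP x' ↔ (fun i : Fin c.n => c.yP (ext x) i) = fun i : Fin c.n => c.yP (ext x') i) ∧ (∀ x x' : Fin c.N → ZMod 2, bpMap c.N c.progsQ x = bpMap c.N c.progsQ x' ↔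 ((fun i : Fin c.n => c.yQ (ext x) i), ext x 0) = ((fun i : Fin c.n => c.yQ (ext x') i), ext x' 0)) := by
  have hP : ∀ x : Fin c.N → ZMod 2, bpMap c.N c.progsP x = (List.range (c.n * c.W)).map fun r =>
      (RawBP.compile c.N (affineBitRaw (c.csP (r / c.W)) (r % c.W))).2.fn (toInput x) := by
    intro x
    rw [sem_bpMap_eq, CVPTup.progsP, List.map_map]
    rfl
  have hbit : ∀ b : Bool, (if b then 1 else 0 : ℕ).testBit 0 = b := by decide
  have hQ : ∀ x : Fin c.N → ZMod 2, bpMap c.N c.progsQ x = ((List.range (c.n * c.W)).map fun r =>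
      (RawBP.compile c.N (affineBitRaw (c.csQ (r / c.W)) (r % c.W))).2.fn (toInput x)) ++
        [ext x 0] := by
    intro x
    rw [sem_bpMap_eq, CVPTup.progsQ, List.map_append, List.map_map, List.map_singleton,
      sem_compile_fn _ _ _ (length_cs c 0).2.2, sem_affineVal_csB, hbit, sem_toInput_eq]
    rfl
  refine ⟨fun x x' => ?_, fun x x' => ?_⟩
  · rw [hP, hP]
    exact sem_ker_blocks c c.csP (fun i => (length_cs c i).1) c.yP
      (fun i hi u => sem_signed_csP c hi u) hWP x x'
  · rw [hQ, hQ, Prod.mk.injEq, ← sem_ker_blocks c c.csQ (fun i => (length_cs c i).2.1) c.yQ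
      (fun i hi u => sem_signed_csQ c hi u) hWQ x x']
    constructor
    · intro h
      have hl : [ext x 0].length = [ext x' 0].length := rfl
      exact ⟨List.append_inj_left' h hl, by simpa using List.append_inj_right' h hl⟩
    · rintro ⟨h1, h2⟩
      rw [h1, h2]

end Summit.PneNP.PneNP.Cruxes.PeaThreeNotInP.LatticeLine
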